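import Literature.Computability.AlgebraicComplexity.GradedInitialSubspace
import HarnessLib

/-!
# The initial subspace of a torus degeneration as ONE graded subspace: exact dimension and
# torus-fixedness (on top of `GradedInitialSubspace.lean`)

Topic `Literature/Computability/AlgebraicComplexity`. `GradedInitialSubspace.lean` (support of the
`R̲(⟨2,2,2⟩) = 7` proof) provides, for a coordinate space `K^σ` graded by `deg : σ → ℤ` and a
subspace `F`, the graded PIECES `inPart deg F d = proj_d (F ∩ V_{≥ d})` of the torus limit
`lim_{s→0} λ(s)·F`, the count `finrank_eq_sum_finrank_inPart` (`dim F = ∑_d dim in_d F`) and the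
inequality `finrank_biSup_inPart_le` (`dim ∑_d in_d F ≤ dim F`). This file assembles the pieces into
the limit subspace itself, `WtInit.stage deg F d₀ n = ∑_{i<n} in_{d₀+i} F` (built up degree by
degree), and adds what the `⟨2,3,3⟩` lower bound (`BorderApolarityCandidates.lean`,
`BorderRank233.lean`) consumes and the existing file does not state:

* `WtInit.finrank_stage_eq` — **`dim (∑_d in_d F) = dim F`** (equality: the pieces sit in distinct
  weight spaces, `WtInit.stage_inf_inPart_eq_bot`, so the sum is direct; this upgrades
  `finrank_biSup_inPart_le`);
* `WtInit.projDeg_mem_stage` — the limit is GRADED (stable under every `proj_d`), i.e. a torus-fixed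
  point;
* `WtInit.mem_stage_of_homogeneous` — weight vectors of `F` survive in the limit;
* `WtInit.projDeg_mem_stage_of_mem` — the generators `proj_d φ`, `φ ∈ F ∩ V_{≥ d}`.

Everything is elementary linear algebra, PROVED; the primitives (`projDeg`, `Vge`, `Fge`, `inPart`,
`finrank_Fge_eq_add`) are those of `GradedInitialSubspace.lean`, not re-defined. [folklore]

## References

* A. Conner, A. Harper, J. M. Landsberg, Forum Math. Pi 11 (2023) e17, arXiv:1911.07981, §2.4
  (torus/Borel-fixed normal forms of the limiting spaces). [ConnerHarperLandsberg2023]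
-/

noncomputable section

open scoped BigOperators

namespace Literature.Computability.AlgebraicComplexity

namespace WtInit

universe u v

variable {K : Type u} [Field K] {σ : Type v} (deg : σ → ℤ)

/-! ## The stages `∑_{i<n} in_{d₀+i} F` -/

/-- **The torus limit, built up degree by degree**: `stage F d₀ n = ∑_{i<n} in_{d₀+i}(F)`.
[cite: ConnerHarperLandsberg2023, §2.4] -/
def stage (F : Submodule K (σ → K)) (d₀ : ℤ) : ℕ → Submodule K (σ → K)
  | 0 => ⊥
  | n + 1 => stage F d₀ n ⊔ inPart deg F (d₀ + n)

/-- `stage F d₀ 0 = 0`. [folklore] -/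
@[simp] theorem stage_zero (F : Submodule K (σ → K)) (d₀ : ℤ) : stage deg F d₀ 0 = ⊥ := rfl

/-- `stage F d₀ (n+1) = stage F d₀ n + in_{d₀+n} F`. [folklore] -/
theorem stage_succ (F : Submodule K (σ → K)) (d₀ : ℤ) (n : ℕ) :
    stage deg F d₀ (n + 1) = stage deg F d₀ n ⊔ inPart deg F (d₀ + n) := rfl

/-- The stages increase. [folklore] -/
theorem stage_mono (F : Submodule K (σ → K)) (d₀ : ℤ) {m n : ℕ} (h : m ≤ n) :
    stage deg F d₀ m ≤ stage deg F d₀ n := by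
  induction h with
  | refl => exact le_rfl
  | step _ ih => exact ih.trans (by rw [stage_succ]; exact le_sup_left)

/-- The pieces of degree `d₀ + i`, `i < n`, lie in stage `n`. [folklore] -/
theorem inPart_le_stage (F : Submodule K (σ → K)) (d₀ : ℤ) {i n : ℕ} (h : i < n) :
    inPart deg F (d₀ + i) ≤ stage deg F d₀ n :=
  (le_sup_right : inPart deg F (d₀ + i) ≤ stage deg F d₀ (i + 1)).trans (stage_mono deg F d₀ h)

/-- The generators: `proj_d φ ∈ stage` for `φ ∈ F ∩ V_{≥ d}`, `d` in the window. [folklore] -/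
theorem projDeg_mem_stage_of_mem (F : Submodule K (σ → K)) (d₀ : ℤ) {i n : ℕ} (h : i < n)
    {φ : σ → K} (hφF : φ ∈ F) (hφV : φ ∈ Vge deg (d₀ + i)) :
    projDeg deg (d₀ + i) φ ∈ stage deg F d₀ n :=
  inPart_le_stage deg F d₀ h ⟨φ, ⟨hφF, hφV⟩, rfl⟩

/-- Elements of stage `n` are supported on degrees `< d₀ + n`. [folklore] -/
theorem apply_eq_zero_of_mem_stage (F : Submodule K (σ → K)) (d₀ : ℤ) :
    ∀ (n : ℕ) {x : σ → K}, x ∈ stage deg F d₀ n → ∀ s, d₀ + n ≤ deg s → x s = 0 := by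
  intro n
  induction n with
  | zero =>
    intro x hx s _
    rw [stage_zero, Submodule.mem_bot] at hx
    simp [hx]
  | succ n ih =>
    intro x hx s hs
    rw [stage_succ, Submodule.mem_sup] at hx
    obtain ⟨y, hy, z, hz, rfl⟩ := hx
    have h1 : y s = 0 := ih hy s (by push_cast at hs; omega)
    have h2 : z s = 0 := apply_eq_zero_of_mem_inPart deg hz (by push_cast at hs; omega)
    simp [h1, h2]

/-- A stage meets the next piece trivially (different weights): the sum of the pieces is direct.
[folklore] -/
theorem stage_inf_inPart_eq_bot (F : Submodule K (σ → K)) (d₀ : ℤ) (n : ℕ) :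
    stage deg F d₀ n ⊓ inPart deg F (d₀ + n) = ⊥ := by
  rw [eq_bot_iff]
  rintro x ⟨hx1, hx2⟩
  rw [Submodule.mem_bot]
  funext s
  by_cases h : deg s = d₀ + n
  · exact apply_eq_zero_of_mem_stage deg F d₀ n hx1 s h.symm.le
  · exact apply_eq_zero_of_mem_inPart deg hx2 h

/-- `proj_d ∘ proj_d = proj_d`, `proj_d ∘ proj_{d'} = 0` (`d ≠ d'`), on elements of a piece.
[folklore] -/
theorem projDeg_of_mem_inPart {F : Submodule K (σ → K)} {d : ℤ} {z : σ → K}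
    (hz : z ∈ inPart deg F d) (d' : ℤ) :
    projDeg deg d' z = if d' = d then z else 0 := by
  funext s
  simp only [projDeg, LinearMap.coe_mk, AddHom.coe_mk]
  by_cases h : deg s = d'
  · rw [if_pos h]
    split_ifs with h'
    · rfl
    · exact apply_eq_zero_of_mem_inPart deg hz (fun h'' => h' (h.symm.trans h''))
  · rw [if_neg h]
    split_ifs with h'
    · subst h'
      exact (apply_eq_zero_of_mem_inPart deg hz h).symm
    · rfl

/-- **Gradedness**: every weight component of an element of a stage lies in the stage (the torus
limit is spanned by weight vectors, i.e. torus fixed). [cite: ConnerHarperLandsberg2023, §2.4] -/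
theorem projDeg_mem_stage (F : Submodule K (σ → K)) (d₀ : ℤ) :
    ∀ (n : ℕ) {x : σ → K}, x ∈ stage deg F d₀ n → ∀ d, projDeg deg d x ∈ stage deg F d₀ n := by
  intro n
  induction n with
  | zero =>
    intro x hx d
    rw [stage_zero, Submodule.mem_bot] at hx
    rw [hx, map_zero]
    exact Submodule.zero_mem _
  | succ n ih =>
    intro x hx d
    rw [stage_succ, Submodule.mem_sup] at hx
    obtain ⟨y, hy, z, hz, rfl⟩ := hx
    rw [map_add]
    refine Submodule.add_mem _ (le_sup_left (a := stage deg F d₀ n) (ih hy d)) ?_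
    rw [projDeg_of_mem_inPart deg hz]
    split_ifs
    · exact le_sup_right (a := stage deg F d₀ n) hz
    · exact Submodule.zero_mem _

/-- Weight vectors of `F` whose degree lies in the window survive in the stage. [folklore] -/
theorem mem_stage_of_homogeneous (F : Submodule K (σ → K)) (d₀ : ℤ) {n i : ℕ} (hi : i < n)
    {x : σ → K} (hxF : x ∈ F) (hx : ∀ s, x s ≠ 0 → deg s = d₀ + i) : x ∈ stage deg F d₀ n := by
  have hxV : x ∈ Vge deg (d₀ + i) := (mem_Vge deg).2 fun s hs => by
    by_contra h
    have := hx s h; omega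
  have hfix : projDeg deg (d₀ + i) x = x := funext fun s => by
    simp only [projDeg, LinearMap.coe_mk, AddHom.coe_mk]
    by_cases h : deg s = d₀ + i
    · simp [h]
    · have : x s = 0 := by
        by_contra h'
        exact h (hx s h')
      simp [h, this]
  exact hfix ▸ projDeg_mem_stage_of_mem deg F d₀ hi hxF hxV

/-! ## Dimension count -/

section Finrank

variable [Fintype σ]

/-- The telescoping identity `dim stage n + dim (F ∩ V_{≥ d₀+n}) = dim F` when all degrees are
`≥ d₀`. [folklore] -/
theorem finrank_stage_add (F : Submodule K (σ → K)) {d₀ : ℤ} (hlo : ∀ s, d₀ ≤ deg s) :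
    ∀ n : ℕ, Module.finrank K (stage deg F d₀ n) + Module.finrank K (Fge deg F (d₀ + n)) =
      Module.finrank K F := by
  intro n
  induction n with
  | zero =>
    rw [stage_zero, finrank_bot, zero_add, Nat.cast_zero, add_zero, Fge_eq_of_le deg F hlo]
  | succ n ih =>
    have hsup := Submodule.finrank_sup_add_finrank_inf_eq (stage deg F d₀ n) (inPart deg F (d₀ + n))
    rw [stage_inf_inPart_eq_bot, finrank_bot, add_zero] at hsup
    have hstep := finrank_Fge_eq_add deg F (d₀ + n)
    rw [stage_succ, Nat.cast_succ, ← add_assoc]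
    omega

/-- **The torus limit has the dimension of `F`**: `dim (∑_{i<n} in_{d₀+i} F) = dim F` over a window
`[d₀, d₀ + n)` containing all degrees (equality; compare `finrank_biSup_inPart_le`).
[cite: ConnerHarperLandsberg2023, §2.4] -/
theorem finrank_stage_eq (F : Submodule K (σ → K)) {d₀ : ℤ} {n : ℕ} (hlo : ∀ s, d₀ ≤ deg s)
    (hhi : ∀ s, deg s < d₀ + n) : Module.finrank K (stage deg F d₀ n) = Module.finrank K F := by
  have h := finrank_stage_add deg F hlo n
  rw [Fge_eq_bot_of_lt deg F hhi, finrank_bot, add_zero] at h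
  exact h

end Finrank

end WtInit

end Literature.Computability.AlgebraicComplexity

end
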